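import Summits.BirchSwinnertonDyer.BirchSwinnertonDyer.Theorems.TeichmullerTwistDescentStarInvolutionCells
import Summits.BirchSwinnertonDyer.BirchSwinnertonDyer.Theorems.TeichmullerTwistDescentCells57FromKato
import Summits.BirchSwinnertonDyer.BirchSwinnertonDyer.Theorems.KatoDescentTamePotSupersingularTameDefectIsogenyInvariance
import Summits.BirchSwinnertonDyer.BirchSwinnertonDyer.Theorems.AdditiveKolyvaginRoadManinFrameResidueProperTwistDegree
import Summits.BirchSwinnertonDyer.Rank1Residual.Additive.GordTorsionFiveSeven
import HarnessLib

/-!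
# Route `TeichmullerTwistDescent`, cruxes LOW (stmt-BirchSwinnertonDyer-23884) and CORNER
# (stmt-BirchSwinnertonDyer-23883): "AT MOST ONCE" ON THE TORSION CORNERS — `ord_p c ≤ 1` on both cells,
# granted Kato's fact and Modularity (star involution, `--supports`)

Cell `pub/bsd-wall` (D-0145 line route-BirchSwinnertonDyer-TeichmullerTwistDescent, rev 2), seat
`bsd-line-ttd-p1` (prover 1/2, g2, item SCMU57). THEOREMS ONLY (no definition, no named fact, no `sorry`);
nothing is booked, no item is closed, BSD is not proved by this.

WHAT. Route rev 2 names the residues of the two Manin cruxes at `p ∈ {5, 7}` GRANTED the PUB bundle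
(`KatoNeronAndCremonaFacts`: F″ = Kato's Néron integrality off the Kosters–Pannekoek exception): the torsion
corners LOW (`SupersingularTorsionOptimalManinUnitFive`: type II at `5` with a `ℚ_5`-rational point of order
`5`; its III-at-`5` and II-at-`7` rows are `(G)`-ordinary, i.e. vacuous under `¬ TypeGOrd`) and CORNER
(`KummerCornerTorsionOptimalManinUnit`: III at `5`, II at `7`, `(G)`-ordinary, with a `ℚ_p`-rational point of
order `p`). Both are UNSTARRED cells. The star involution (companion files `…StarInvolution.lean`,
`…StarInvolutionCells.lean`) bounds an unstarred optimal curve by a `p`-good datum on its STARRED twist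
(`padicValInt_c_le_one_of_twist_datum`), and the starred twist's class has NO local `p`-torsion (Mazur 1977
III §5: `p`-torsion in `E(ℚ_p)` forces `ord_p Δ_min ≤ 3`), so Kato's fact makes its optimal curve `p`-good
(`TeichmullerTwistDescent.cell57_of_kato57_of_noPTorsion`, seat ttd-p2). Hence:

* §1 `padicValInt_c_le_one_of_unstarred_of_kato` — the core: F″ + Modularity + "every member of the twisted
  class has `ord_p Δ_min ≥ 4`" ⟹ `ord_p c(D) ≤ 1` for the lattice-optimal datum of an unstarred `W`.
  `four_le_of_isIsogenous_of_padicValInt_eq_eight` — for the twist of a type-II curve (type IV*, `e = 3`)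
  that class condition holds WITHOUT Dokchitser–Dokchitser: `gcd(12, ord_p Δ_min)` is a `ℚ`-isogeny
  invariant (`TameDefectIsogenyInvariance`), and `gcd = 4` forces `ord_p Δ_min ∈ {4, 8}`.
* §2 **`padicValInt_c_le_one_of_supersingularTorsionCell`: on LOW's own binders, granted
  `KatoNeronAndCremonaFacts` and `PublishedInputsAdditiveKoly` (Modularity), `ord_p c(D) ≤ 1`** — no `hDD`.
* §3 **`padicValInt_c_le_one_of_kummerCornerCell`: on CORNER's own binders, granted the same two bundles and
  Dokchitser–Dokchitser, `ord_p c(D) ≤ 1`** (the twist III* at `5` has `e = 4`, whose class could a priori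
  contain type III; `hDD` excludes it via `ManinFrameResidueProperTwistDegree.not_typeGOrd_or_four_lt_of_isIsogenous`).

READING. This is Edixhoven's printed "in that case `p` divides `c` at most once" (1991 Thm. 3, `p > 7`,
exceptional types II/III/IV) carried to the two torsion corners at `p ∈ {5, 7}` GRANTED Kato: a
counterexample to Manin's conjecture inside LOW or CORNER has `ord_p c₀ = 1` exactly. It closes neither
cell.

References: [EdixhovenManin1991] Thm. 3 (typescript L115–118), §4 (L602–640, L695–710); [Kato2004Asterisque]
(8.1.3), Thm. 9.7; [Mazur1977] Ch. III §5; [KostersPannekoek2017] Thm. 1, Cor. 2;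
[DokchitserDokchitser2015LocalInvariants] Thm. 5.1 (1); [SilvermanAEC2009] VII.5.1, VII.7.2.
-/

set_option autoImplicit false
-- single-conjunct summit: `Summit.BirchSwinnertonDyer.BirchSwinnertonDyer.…` repeats the name by design
set_option linter.dupNamespace false

noncomputable section

open scoped Classical NumberField

open WeierstrassCurve IsDedekindDomain Rat.HeightOneSpectrum
  Literature.NumberTheory.EllipticCurves Literature.NumberTheory.EllipticCurves.ModularForms
  Literature.NumberTheory.EllipticCurves.Rank1Residual Literature.NumberTheory.DiophantineGeometry
  Summit.BirchSwinnertonDyer.Rank1Residual Summit.BirchSwinnertonDyer.Rank1Residual.Additive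
  Literature.NumberTheory.Automorphic
open Summit.BirchSwinnertonDyer.BirchSwinnertonDyer.Theorems.TeichmullerTwistDescent
open Summit.BirchSwinnertonDyer.BirchSwinnertonDyer.Theses.TeichmullerTwistDescent

namespace Summit.BirchSwinnertonDyer.BirchSwinnertonDyer.Theorems.TeichmullerTwistDescentStarInvolution

/-! ### §1 The core: an unstarred optimal curve whose starred twist class has no local `p`-torsion -/

section Core

variable (p : ℕ) [hp : Fact p.Prime]

/-- **"At most once" at `p ∈ {5, 7}` from Kato on the starred twist.** Granted Kato's fact (F″,
`kato_neron_isIntegral_twistedSymbolSum_of_additive_five_le`) and Modularity (`hnf`): let `W/ℚ` be globally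
minimal, additive at `p ∈ {5, 7}` with `E[p]` irreducible and no `Iₙ*` fibre at `(p)`, of UNSTARRED type
(`ord_p Δ_min(W) < 6`), with a lattice-optimal conductor-level datum `D`; let `C • W^{(p*)} = V` be a globally
minimal model of the twist, and suppose every globally minimal `V₀ ∼ V` (additive at `p`) has
`4 ≤ ord_p Δ_min(V₀)` — so that `V₀(ℚ_p)[p] = 0` (Mazur 1977 III §5,
`Additive.eq_zero_of_prime_nsmul_eq_zero_of_addv_of_four_le`). Then **`ord_p c(D) ≤ 1`**: Kato's cell
(`TeichmullerTwistDescent.cell57_of_kato57_of_noPTorsion`) makes the optimal curve of the class of `V`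
`p`-good, the datum moves to `V` (`exists_datum_not_dvd_of_forall_optimal`), and the star involution
bounds the unstarred side (`padicValInt_c_le_one_of_twist_datum`, `ord_p u(C) = 0`).
[cite: Kato2004Asterisque, Thm. 9.7 (p. 189)] [cite: Mazur1977, Ch. III §5, Step 1, p. 158]
[cite: EdixhovenManin1991, §4 (typescript L602–640)] -/
theorem padicValInt_c_le_one_of_unstarred_of_kato
    (hK : kato_neron_isIntegral_twistedSymbolSum_of_additive_five_le) (hnf : exists_isNewformOf)
    (hp57 : p = 5 ∨ p = 7) (W V : WeierstrassCurve ℚ) [W.IsElliptic] [W.IsGloballyMinimal]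
    [NeZero (W.conductorNorm ℤ)] [V.IsElliptic] [V.IsGloballyMinimal]
    (hadd : Addv W p) (hirr : Irr W p) (hnI : ∀ n : ℕ, W.kodairaSymbolAt (placeOf p) ≠ .Istar n)
    (hW6 : padicValInt p W.minimalDiscriminantInt < 6)
    (C : VariableChange ℚ) (hC : C • W.quadraticTwist ((-1 : ℚ) ^ (p / 2) * p) = V)
    (hfour : ∀ (V₀ : WeierstrassCurve ℚ) [V₀.IsElliptic] [V₀.IsGloballyMinimal],
      IsIsogenous V V₀ → Addv V₀ p → 4 ≤ padicValInt p V₀.minimalDiscriminantInt)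
    (D : ModularParametrizationData W (W.conductorNorm ℤ))
    (hopt : ∀ z ∈ D.L.lattice, ∃ w ∈ periodLattice D.f, z = D.c * w) :
    padicValInt p D.c ≤ 1 := by
  have hp5 : 5 ≤ p := by rcases hp57 with rfl | rfl <;> norm_num
  have hp2 : p ≠ 2 := by omega
  have hjW : 0 ≤ padicValRat p W.j :=
    ManinFrameResidueProperRTameTwist.padicValRat_j_nonneg_of_addv_of_forall_kodairaSymbolAt_ne_Istar
      W hp2 hadd (placeOf p) (natGenerator_placeOf p) hnI
  obtain ⟨haddV, -, -⟩ := addv_of_twist_pStar p hp2 W V hjW hW6 C hC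
  obtain ⟨hu, -⟩ := padicValRat_u_eq_zero_and_padicValInt_eq_of_twist_pStar p hp2 W V hW6 C hC
  have hirrV : Irr V p :=
    BurungaleSkinnerTianWan2024.hasIrreducibleModPGaloisRep_of_smul_eq_quadraticTwist W V p (pStar_ne_zero p) (C := C⁻¹)
      (by rw [← hC, inv_smul_smul]) hirr
  haveI : NeZero (V.conductorNorm ℤ) := ⟨(conductorNorm_pos_holds V).ne'⟩
  have hNV : V.conductorNorm ℤ = W.conductorNorm ℤ :=
    conductorNorm_eq_of_twist_pStar p hp5 W V hadd haddV C hC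
  -- a `p`-good datum on `V`: Kato at the optimal curve of its class, which has no local `p`-torsion
  obtain ⟨D', hc'⟩ := exists_datum_not_dvd_of_forall_optimal p hnf V hirrV
    (fun V₀ _ _ _ D₀ hiso hopt₀ ↦ by
      have haddV₀ : Addv V₀ p := (X2.addv_iff_of_isIsogenous hiso).mp haddV
      have hirrV₀ : Irr V₀ p := (X12.irr_iff_of_isIsogenous hiso p).mp hirrV
      have h4 : 4 ≤ padicValInt p V₀.minimalDiscriminantInt := hfour V₀ hiso haddV₀
      have hPT : ∀ P : (V₀.baseChange ℚ_[p]).toAffine.Point, p • P = 0 → P = 0 := fun P hP ↦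
        eq_zero_of_prime_nsmul_eq_zero_of_addv_of_four_le V₀ p hp5 haddV₀ h4 hP
      exact cell57_of_kato57_of_noPTorsion hK V₀ p D₀ hp57 haddV₀ hirrV₀ hPT hopt₀)
  exact padicValInt_c_le_one_of_twist_datum p hp2 W V hadd C hC hu D hopt
    (sq_dvd_conductorNorm_of_not_good_of_not_mult hadd) (dvd_of_eq hNV) D' hc'

/-- **`4 ≤ ord_p Δ_min` along the class of the starred twist of a type-II curve, WITHOUT
Dokchitser–Dokchitser.** If `V` is globally minimal, additive and potentially good at `p ≥ 5` with
`ord_p Δ_min(V) = 8` (type IV*), then every globally minimal `V₀ ∼ V` additive at `p` has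
`ord_p Δ_min(V₀) ∈ {4, 8}`, in particular `≥ 4`: `gcd(12, ord_p Δ_min)` is a `ℚ`-isogeny invariant at a
potentially good `p ≥ 5` (tree theorem `TameDefectIsogenyInvariance.gcd_padicValInt_minimalDiscriminantInt_eq_of_isIsogenous`,
the semistability defect `e = 3`), and `gcd(12, v) = 4` forces `v ∈ {4, 8}` on the Kodaira list.
[cite: SilvermanAEC2009, Prop. VII.5.1, Cor. VII.7.2] [cite: SilvermanATAEC1994, IV Table 4.1 (PDF p. 365)] -/
theorem four_le_of_isIsogenous_of_padicValInt_eq_eight (hp5 : 5 ≤ p) (V V₀ : WeierstrassCurve ℚ)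
    [V.IsElliptic] [V.IsGloballyMinimal] [V₀.IsElliptic] [V₀.IsGloballyMinimal]
    (hjV : 0 ≤ padicValRat p V.j) (h8 : padicValInt p V.minimalDiscriminantInt = 8)
    (hiso : IsIsogenous V V₀) (haddV₀ : Addv V₀ p) :
    4 ≤ padicValInt p V₀.minimalDiscriminantInt := by
  have hjV₀ : 0 ≤ padicValRat p V₀.j :=
    TameDefectIsogenyInvariance.padicValRat_j_nonneg_of_isIsogenous hp5 hjV hiso
  have hgcd := TameDefectIsogenyInvariance.gcd_padicValInt_minimalDiscriminantInt_eq_of_isIsogenous hp5 hjV hiso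
  rw [h8] at hgcd
  have hvV₀ := padicValInt_minimalDiscriminantInt_mem_of_addv_of_padicValRat_j_nonneg V₀ p hp5 haddV₀ hjV₀
  rcases hvV₀ with h | h | h | h | h | h | h <;> rw [h] at hgcd ⊢ <;> revert hgcd <;> norm_num

end Core

/-! ### §2 LOW: `ord₅ c ≤ 1` on the supersingular torsion cell, granted the PUB bundle and Modularity -/

section Low

/-- **"At most once" on LOW** (`SupersingularTorsionOptimalManinUnitFive`, stmt-BirchSwinnertonDyer-23884),
**granted `KatoNeronAndCremonaFacts` (F″) and `PublishedInputsAdditiveKoly` (Modularity)**: on the cell's own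
binders — `W` globally minimal, `(p, ord_p Δ_min) ∈ {(5,2),(5,3),(7,2)}`, additive, `E[p]` irreducible, NOT
`(G)`-ordinary, a `ℚ_p`-rational point of order `p`, `D` lattice-optimal at the conductor level — the Manin
valuation satisfies **`ord_p c(D) ≤ 1`**. The sub-cells `(5, 3)` (Kodaira III: `e = 4 ∣ p − 1`) and `(7, 2)`
(Kodaira II at `7`: `e = 6 ∣ p − 1`) are `(G)`-ordinary (`Additive.typeGOrd_of_addv_of_subGordHigher`), so
vacuous here; on `(5, 2)` (type II at `5`, `e = 6`, potentially supersingular) the starred twist is IV* and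
its class has no local `5`-torsion WITHOUT Dokchitser–Dokchitser (`four_le_of_isIsogenous_of_padicValInt_eq_eight`),
so `padicValInt_c_le_one_of_unstarred_of_kato` applies. The cell itself (`5 ∤ c`) stays open; this is
Edixhoven's "at most once" (printed for `p > 7`) on the one supercuspidal cell below `7`.
[cite: Kato2004Asterisque, Thm. 9.7 (p. 189)] [cite: Mazur1977, Ch. III §5, Step 1, p. 158]
[cite: EdixhovenManin1991, Thm. 3 and §4] [cite: KostersPannekoek2017, Cor. 2] -/
theorem padicValInt_c_le_one_of_supersingularTorsionCell (hPK : KatoNeronAndCremonaFacts)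
    (hP : PublishedInputsAdditiveKoly) :
    ∀ (W : WeierstrassCurve ℚ) [W.IsElliptic] [W.IsGloballyMinimal] (p : ℕ) [Fact p.Prime]
      [NeZero (W.conductorNorm ℤ)] (D : ModularParametrizationData W (W.conductorNorm ℤ)),
      ((p = 5 ∧ (padicValInt p W.minimalDiscriminantInt = 2 ∨ padicValInt p W.minimalDiscriminantInt = 3)) ∨
        (p = 7 ∧ padicValInt p W.minimalDiscriminantInt = 2)) →
      Addv W p → Irr W p → ¬ TypeGOrd W p →
      (∃ P : (W.baseChange ℚ_[p]).toAffine.Point, p • P = 0 ∧ P ≠ 0) →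
      (∀ z ∈ D.L.lattice, ∃ w ∈ periodLattice D.f, z = D.c * w) → padicValInt p D.c ≤ 1 := by
  intro W _ _ p _ _ D hcell hadd hirr hnG _ hopt
  have hK := hPK.1
  have hnf : exists_isNewformOf := hP.2.2.2.2.2.1
  have hp57 : p = 5 ∨ p = 7 := by rcases hcell with ⟨h, -⟩ | ⟨h, -⟩ <;> simp [h]
  have hp5 : 5 ≤ p := by rcases hp57 with rfl | rfl <;> norm_num
  have hp2 : p ≠ 2 := by omega
  have hle4 : padicValInt p W.minimalDiscriminantInt ≤ 4 := by
    rcases hcell with ⟨-, h | h⟩ | ⟨-, h⟩ <;> omega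
  have hnI : ∀ n : ℕ, W.kodairaSymbolAt (placeOf p) ≠ .Istar n :=
    forall_ne_Istar_of_padicValInt_le_four W p hp5 hadd hle4
  have hjW : 0 ≤ padicValRat p W.j :=
    ManinFrameResidueProperRTameTwist.padicValRat_j_nonneg_of_addv_of_forall_kodairaSymbolAt_ne_Istar
      W hp2 hadd (placeOf p) (natGenerator_placeOf p) hnI
  have hcW : CondExpTwo W p := condExpTwo_of_addv_of_five_le W p hp5 hadd
  -- the two `(G)`-ordinary sub-cells are vacuous
  rcases hcell with ⟨rfl, h2 | h3⟩ | ⟨rfl, h2⟩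
  · -- type II at `5`: the starred twist is IV*
    obtain ⟨V, hVe, hVm, C, hC⟩ := exists_minimal_twist_pStar 5 W
    haveI := hVe
    haveI := hVm
    have hW6 : padicValInt 5 W.minimalDiscriminantInt < 6 := by omega
    obtain ⟨-, hjV, -⟩ := addv_of_twist_pStar 5 (by norm_num) W V hjW hW6 C hC
    obtain ⟨-, h8'⟩ := padicValRat_u_eq_zero_and_padicValInt_eq_of_twist_pStar 5 (by norm_num) W V hW6 C hC
    have h8 : padicValInt 5 V.minimalDiscriminantInt = 8 := by omega
    exact padicValInt_c_le_one_of_unstarred_of_kato 5 hK hnf (Or.inl rfl) W V hadd hirr hnI hW6 C hC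
      (fun V₀ _ _ hiso haddV₀ ↦
        four_le_of_isIsogenous_of_padicValInt_eq_eight 5 (by norm_num) V V₀ hjV h8 hiso haddV₀) D hopt
  · -- type III at `5` is `(G)`-ordinary (`e = 4 ∣ 4`)
    exfalso
    refine hnG (typeGOrd_of_addv_of_subGordHigher W 5 hp5 hadd ⟨⟨not_lt.mpr hjW, hcW, ?_⟩, ?_⟩) <;>
      unfold semistabilityIndex <;> rw [h3] <;> norm_num
  · -- type II at `7` is `(G)`-ordinary (`e = 6 ∣ 6`)
    exfalso
    refine hnG (typeGOrd_of_addv_of_subGordHigher W 7 hp5 hadd ⟨⟨not_lt.mpr hjW, hcW, ?_⟩, ?_⟩) <;>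
      unfold semistabilityIndex <;> rw [h2] <;> norm_num

end Low

/-! ### §3 CORNER: `ord_p c ≤ 1` on the Kummer corner, granted PUB, Modularity and Dokchitser–Dokchitser -/

section Corner

/-- **"At most once" on CORNER** (`KummerCornerTorsionOptimalManinUnit`, stmt-BirchSwinnertonDyer-23883),
**granted `KatoNeronAndCremonaFacts` (F″), `PublishedInputsAdditiveKoly` (Modularity) and
Dokchitser–Dokchitser** (`hDD`, `ord_p Δ_min` along prime-to-`p` isogenies): on the cell's own binders —
`(p, ord_p Δ_min) ∈ {(5,3),(7,2)}` (Kodaira III at `5`, II at `7`: `e = p − 1`), additive, `E[p]`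
irreducible, `(G)`-ordinary, a `ℚ_p`-rational point of order `p`, `D` lattice-optimal at the conductor
level — **`ord_p c(D) ≤ 1`**. The starred twist (III* at `5`, IV* at `7`) is `(G)`-ordinary with
`ord_p Δ_min > 4`, which persists along its class under `Irr` by `hDD`
(`ManinFrameResidueProperTwistDegree.not_typeGOrd_or_four_lt_of_isIsogenous`); so that class has no local
`p`-torsion, Kato makes its optimal curve `p`-good, and the involution bounds the corner curve. (For the
II-at-`7` half `hDD` is avoidable as in §2; kept uniform.) [cite: Kato2004Asterisque, Thm. 9.7 (p. 189)]
[cite: Mazur1977, Ch. III §5, Step 1, p. 158] [cite: DokchitserDokchitser2015LocalInvariants, Thm. 5.1 (1)]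
[cite: EdixhovenManin1991, Thm. 3 and §4] -/
theorem padicValInt_c_le_one_of_kummerCornerCell (hPK : KatoNeronAndCremonaFacts)
    (hP : PublishedInputsAdditiveKoly)
    (hDD : dokchitser_padicValInt_minimalDiscriminantInt_eq_of_isogeny_of_not_dvd_degree) :
    ∀ (W : WeierstrassCurve ℚ) [W.IsElliptic] [W.IsGloballyMinimal] (p : ℕ) [Fact p.Prime]
      [NeZero (W.conductorNorm ℤ)] (D : ModularParametrizationData W (W.conductorNorm ℤ)),
      ((p = 5 ∧ padicValInt p W.minimalDiscriminantInt = 3) ∨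
        (p = 7 ∧ padicValInt p W.minimalDiscriminantInt = 2)) →
      Addv W p → Irr W p → TypeGOrd W p →
      (∃ P : (W.baseChange ℚ_[p]).toAffine.Point, p • P = 0 ∧ P ≠ 0) →
      (∀ z ∈ D.L.lattice, ∃ w ∈ periodLattice D.f, z = D.c * w) → padicValInt p D.c ≤ 1 := by
  intro W _ _ p _ _ D hcell hadd hirr hG _ hopt
  have hK := hPK.1
  have hnf : exists_isNewformOf := hP.2.2.2.2.2.1
  have hp57 : p = 5 ∨ p = 7 := by rcases hcell with ⟨h, -⟩ | ⟨h, -⟩ <;> simp [h]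
  have hp5 : 5 ≤ p := by rcases hp57 with rfl | rfl <;> norm_num
  have hp2 : p ≠ 2 := by omega
  have hle4 : padicValInt p W.minimalDiscriminantInt ≤ 4 := by
    rcases hcell with ⟨-, h⟩ | ⟨-, h⟩ <;> omega
  have hW6 : padicValInt p W.minimalDiscriminantInt < 6 := by omega
  have hnI : ∀ n : ℕ, W.kodairaSymbolAt (placeOf p) ≠ .Istar n :=
    forall_ne_Istar_of_padicValInt_le_four W p hp5 hadd hle4
  have hjW : 0 ≤ padicValRat p W.j := padicValRat_j_nonneg_of_typeGOrd W p hG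
  obtain ⟨V, hVe, hVm, C, hC⟩ := exists_minimal_twist_pStar p W
  haveI := hVe
  haveI := hVm
  obtain ⟨haddV, hjV, -⟩ := addv_of_twist_pStar p hp2 W V hjW hW6 C hC
  obtain ⟨-, hordV⟩ := padicValRat_u_eq_zero_and_padicValInt_eq_of_twist_pStar p hp2 W V hW6 C hC
  have hirrV : Irr V p :=
    BurungaleSkinnerTianWan2024.hasIrreducibleModPGaloisRep_of_smul_eq_quadraticTwist W V p (pStar_ne_zero p) (C := C⁻¹)
      (by rw [← hC, inv_smul_smul]) hirr
  -- the starred twist is `(G)`-ordinary with `ord_p Δ_min > 4`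
  have hGV : TypeGOrd V p :=
    (typeGOrd_iff_of_star_pair p hp5 V W haddV hadd hjV hjW (by omega)).mpr hG
  have h4V : 4 < padicValInt p V.minimalDiscriminantInt := by omega
  refine padicValInt_c_le_one_of_unstarred_of_kato p hK hnf hp57 W V hadd hirr hnI hW6 C hC
    (fun V₀ _ _ hiso haddV₀ ↦ ?_) D hopt
  rcases ManinFrameResidueProperTwistDegree.not_typeGOrd_or_four_lt_of_isIsogenous (p := p) hDD hp5 haddV
      hirrV hiso h4V with hnG₀ | h4
  · exact absurd ((typeGOrd_iff_of_isIsogenous hp2 haddV hiso).mp hGV) hnG₀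
  · omega

end Corner

end Summit.BirchSwinnertonDyer.BirchSwinnertonDyer.Theorems.TeichmullerTwistDescentStarInvolution

end
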